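import Literature.AlgebraicGeometry.Resolution.PrimeDivisorIdeals
import Literature.AlgebraicGeometry.Resolution.PointBlowupHsFunMono
import Literature.AlgebraicGeometry.Resolution.CompleteFiniteness
import Literature.AlgebraicGeometry.CossartPiltant200819.Cor13IntegralModels2019
import HarnessLib

/-!
# [OURS · L1 W4.5(b) · EL♮] T-MULTISEC — RAMIFIED MULTISECTIONS through a closed special-fibre point of a proper
# scheme over a complete DVR (crux `EquisingularLiftNat` = stmt-ResolutionOfSingularities-20038)

HONEST FRAMING. OURS (cell res-hironaka, crux chain w45b, slot W4.5(b)); NOT a statement of any manuscript; AI-written,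
weaker than expert review. Helper `--supports stmt-ResolutionOfSingularities-20038 --as helper`. Target T-MULTISEC of
res-L1-w45b-lead-2 (MEMO-2 v1.3 §7 + TARGET 2026-08-27T06:51:13Z: «O complete DVR, `P → Spec O` proper with `P` regular,
`b` a closed point of the special fibre ⇒ ∃ `C : P.IdealSheafData` with `C.subscheme` regular (dim 1), `Flat (C ↪ P → Spec O)`,
`supp C ∩ special fibre = {b}`, `supp C` finite over `O`»; the device «surface point blow-ups are admissible everywhere»).

THIS FILE = the SCHEME-LEVEL BRICKS (the ring-level brick «a regular local ring has a prime `𝔭` with `R/𝔭` a DVR AVOIDING a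
given non-zero element» is `Literature.RingTheory.RegularLocalRing` business, cf. `…/QuotientDVR.lean`; res-type-097 named):

* `closure_fromSpecStalk_eq_pair` — for `r : P → Spec O` separated, `b ∈ P` and a prime `𝔭 ⊂ 𝒪_{P,b}` with `𝒪_{P,b}/𝔭` a
  DVR such that the structure map `O → 𝒪_{P,b}/𝔭` is INTEGRAL: the generisation `c` of `b` defined by `𝔭` has
  `closure {c} = {c, b}`. [`Spec (𝒪_{P,b}/𝔭) → P` is integral over `Spec O` hence universally closed
  (Mathlib `IsIntegralHom.of_comp` + separatedness); its image `{c, b}` is closed.]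
* `module_finite_quotient_stalk_of_isAdicComplete` — the finiteness input over a COMPLETE `O`: if `𝒪_{P,b}/𝔭` is a DVR in which
  the uniformizer of `O` is non-zero and `O → κ(b)` is onto (a `k`-rational point), then `𝒪_{P,b}/𝔭` is a finite `O`-module
  (tree `module_finite_of_isAdicComplete_of_residue_surjective`, Matsumura Thm. 8.4 / proof of 29.4 (iii)).
* `exists_multisection` — **T-MULTISEC**: `O` a complete DVR, `r : P → Spec O` proper, `b` a point of the special fibre with
  `𝒪_{P,b}` regular, `O → 𝒪_{P,b}` injective (e.g. `P` integral dominating `Spec O`) and `O → κ(b)` onto; given ANY prime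
  `𝔭 ⊂ 𝒪_{P,b}` with `𝒪_{P,b}/𝔭` a DVR not containing the uniformizer (the ring brick), the ideal sheaf
  `C := 𝓘_{closure {c}}` of the generisation `c` satisfies: `supp C = {c, b}` with `r c ≠ s₀`, `V(C)` INTEGRAL and REGULAR,
  `V(C) ↪ P → Spec O` FLAT, `supp C ∩ r⁻¹{s₀} = {b}`, and `C_b = 𝔭` (so a trace condition `𝔭 + (u) = 𝔪_b` from the ring brick
  reads `I_C·𝒪_{S,b} = 𝔪_{S,b}` for a surface `S ∋ b` with `lin I_S = ⟨ū⟩`).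

References: H. Matsumura, *Commutative Ring Theory* Thm. 8.4 and proof of Thm. 29.4 (iii) [Matsumura1987]; Stacks 01J7, 01W6
[StacksProject]; R. Hartshorne, *Algebraic Geometry* III Prop. 9.7 (flat = torsion-free over a DVR) [Hartshorne1977] — through
the cited tree files. OURS planning text (index only): L/res-L1-w45b-lead-2 MEMO-2 v1.3 §7.
-/

set_option linter.dupNamespace false -- mandated namespace `Summit.<Summit>.<Problem>` of this single-conjunct summit

open CategoryTheory AlgebraicGeometry TopologicalSpace Topology IsLocalRing
open AlgebraicGeometry.Scheme.IdealSheafData Literature.AlgebraicGeometry.Resolution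

namespace Summit.ResolutionOfSingularities.ResolutionOfSingularities.Cruxes.EquisingularLiftNat.Sections

/-! ## The closure of a generisation whose local quotient is integral over the base -/

/-- **`closure {c} = {c, b}`.** Let `r : P → Spec O` be separated, `b ∈ P`, and `𝔭 ⊂ 𝒪_{P,b}` a prime with `𝒪_{P,b}/𝔭` a
discrete valuation ring such that the structure map `O → 𝒪_{P,b}/𝔭` is INTEGRAL. Then the generisation `c` of `b` defined by
`𝔭` (Mathlib `Scheme.fromSpecStalk`) has closure `{c, b}`: the morphism `Spec (𝒪_{P,b}/𝔭) → P` is integral over `Spec O`,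
hence integral (`IsIntegralHom.of_comp`, `r` separated), hence universally closed, and its image is `{c, b}` (the two points
of the spectrum of a DVR). [cite: StacksProject, Tag 01W6] -/
theorem closure_fromSpecStalk_eq_pair {O : Type} [CommRing O] {P : Scheme.{0}} (r : P ⟶ Spec (.of O))
    [IsSeparated r] (b : P) (p : Ideal (P.presheaf.stalk b)) [hp : p.IsPrime]
    [IsDiscreteValuationRing (P.presheaf.stalk b ⧸ p)]
    (hint : ((Ideal.Quotient.mk p).comp ((Scheme.ΓSpecIso (.of O)).inv ≫
      (Spec (.of O)).presheaf.germ ⊤ (r b) trivial ≫ r.stalkMap b).hom).IsIntegral) :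
    closure ({P.fromSpecStalk b ⟨p, hp⟩} : Set P) = {P.fromSpecStalk b ⟨p, hp⟩, b} := by
  set c := P.fromSpecStalk b ⟨p, hp⟩ with hc
  set h : Spec (.of (P.presheaf.stalk b ⧸ p)) ⟶ P :=
    Spec.map (CommRingCat.ofHom (Ideal.Quotient.mk p)) ≫ P.fromSpecStalk b with hh
  have hcomp : h ≫ r = Spec.map ((Scheme.ΓSpecIso (.of O)).inv ≫ (Spec (.of O)).presheaf.germ ⊤ (r b) trivial ≫
      r.stalkMap b ≫ CommRingCat.ofHom (Ideal.Quotient.mk p)) := by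
    rw [hh, Category.assoc, ← Scheme.SpecMap_stalkMap_fromSpecStalk, Spec.fromSpecStalk_eq, ← Spec.map_comp,
      ← Spec.map_comp]
    rfl
  haveI : IsIntegralHom (h ≫ r) := by
    rw [hcomp, IsIntegralHom.SpecMap_iff]
    exact hint
  haveI : IsIntegralHom h := IsIntegralHom.of_comp h r
  have hcl : IsClosed (Set.range h) := h.isClosedMap.isClosed_range
  -- the images of the two points of `Spec (𝒪_{P,b}/𝔭)`
  have hgen : h ⟨⊥, Ideal.isPrime_bot⟩ = c := by
    rw [hh, Scheme.Hom.comp_apply, hc]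
    congr 1
    apply PrimeSpectrum.ext
    rw [Spec.map_apply, PrimeSpectrum.comap_asIdeal, CommRingCat.hom_ofHom, ← RingHom.ker_eq_comap_bot,
      Ideal.mk_ker]
  have hclosed : h (closedPoint _) = b := by
    rw [hh, Scheme.Hom.comp_apply]
    have hmax : (Spec.map (CommRingCat.ofHom (Ideal.Quotient.mk p))) (closedPoint _) =
        closedPoint (P.presheaf.stalk b) := by
      apply PrimeSpectrum.ext
      rw [Spec.map_apply, PrimeSpectrum.comap_asIdeal, CommRingCat.hom_ofHom]
      haveI : (closedPoint (P.presheaf.stalk b ⧸ p)).asIdeal.IsMaximal := IsLocalRing.maximalIdeal.isMaximal _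
      exact IsLocalRing.eq_maximalIdeal (Ideal.comap_isMaximal_of_surjective _ Ideal.Quotient.mk_surjective)
    rw [hmax]
    exact Scheme.fromSpecStalk_closedPoint
  have hpts : ∀ q : Spec (.of (P.presheaf.stalk b ⧸ p)), h q = c ∨ h q = b := by
    intro q
    by_cases h0 : q.asIdeal = ⊥
    · left
      have hq : q = ⟨⊥, Ideal.isPrime_bot⟩ := PrimeSpectrum.ext h0
      rw [hq, hgen]
    · right
      have hq : q = closedPoint (P.presheaf.stalk b ⧸ p) :=
        PrimeSpectrum.ext (IsLocalRing.eq_maximalIdeal (q.isPrime.isMaximal h0))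
      rw [hq, hclosed]
  have hrange : Set.range h = {c, b} := by
    apply le_antisymm
    · rintro _ ⟨q, rfl⟩
      rcases hpts q with hq | hq
      · rw [hq]; exact Or.inl rfl
      · rw [hq]; exact Or.inr rfl
    · intro y hy
      rcases hy with hy | hy
      · exact ⟨_, hgen.trans hy.symm⟩
      · exact ⟨_, hclosed.trans (Set.mem_singleton_iff.mp hy).symm⟩
  apply le_antisymm
  · refine closure_minimal (Set.singleton_subset_iff.mpr ?_) (hrange ▸ hcl)
    exact Or.inl rfl
  · intro y hy
    rcases hy with hy | hy
    · rw [hy]; exact subset_closure rfl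
    · rw [Set.mem_singleton_iff.mp hy]
      have hcb : c ⤳ b := by
        have : c ∈ Set.range (P.fromSpecStalk b) := ⟨_, rfl⟩
        rwa [Scheme.range_fromSpecStalk] at this
      exact specializes_iff_mem_closure.mp hcb

/-! ## The structure map `O → 𝒪_{P,b}` at a special-fibre point is local -/

/-- At a point `b` of the special fibre (`r b = s₀`), an element `a ∈ O` whose germ `O → 𝒪_{P,b}` is a unit is a unit of
`O` (the germ of `a` at the closed point `s₀ ∈ Spec O` is a unit iff `a ∉ 𝔪_O`). [folklore] -/
theorem isUnit_of_isUnit_stalkMap_germ {O : Type} [CommRing O] [IsLocalRing O] {P : Scheme.{0}} (r : P ⟶ Spec (.of O))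
    {b : P} (hb : r b = closedPoint O) {a : O}
    (ha : IsUnit (((Scheme.ΓSpecIso (.of O)).inv ≫ (Spec (.of O)).presheaf.germ ⊤ (r b) trivial ≫ r.stalkMap b).hom a)) :
    IsUnit a := by
  have h1 : IsUnit ((Spec (.of O)).presheaf.germ ⊤ (r b) trivial ((Scheme.ΓSpecIso (.of O)).inv a)) :=
    isUnit_of_map_unit (r.stalkMap b).hom _ ha
  rw [← Scheme.mem_basicOpen_top, basicOpen_eq_of_affine, hb] at h1
  by_contra hna
  exact (PrimeSpectrum.mem_basicOpen _ _).mp h1 ((IsLocalRing.mem_maximalIdeal a).mpr hna)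

/-! ## Finiteness over a complete base -/

/-- **Finiteness over a COMPLETE `O`.** Let `O` be a complete discrete valuation ring, `r : P → Spec O`, `b` a point of the
special fibre, `𝔭 ⊂ 𝒪_{P,b}` a prime with `A := 𝒪_{P,b}/𝔭` a discrete valuation ring in which (the image of) a uniformizer of
`O` is non-zero, and suppose `O → κ(b)` is onto (`b` is a `k`-rational point). Then `A` is a finite `O`-module for the structure
map `O → 𝒪_{P,b} → A`, in particular that map is integral. (Tree `module_finite_of_isAdicComplete_of_residue_surjective`:
`A` is `𝔪_A`-adically separated, `𝔪_O A = 𝔪_A^N` since `A` is a DVR, `O → A/𝔪_A` onto.)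
[cite: Matsumura1987, Thm. 8.4] -/
theorem isIntegral_quotient_stalk_of_isAdicComplete {O : Type} [CommRing O] [IsDomain O] [IsDiscreteValuationRing O]
    [IsAdicComplete (maximalIdeal O) O] {P : Scheme.{0}} (r : P ⟶ Spec (.of O)) {b : P} (hb : r b = closedPoint O)
    (p : Ideal (P.presheaf.stalk b)) [hp : p.IsPrime] [IsDiscreteValuationRing (P.presheaf.stalk b ⧸ p)]
    (hres : Function.Surjective ((residue (P.presheaf.stalk b)).comp ((Scheme.ΓSpecIso (.of O)).inv ≫
      (Spec (.of O)).presheaf.germ ⊤ (r b) trivial ≫ r.stalkMap b).hom))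
    (hne : ∃ a ∈ maximalIdeal O, Ideal.Quotient.mk p (((Scheme.ΓSpecIso (.of O)).inv ≫
      (Spec (.of O)).presheaf.germ ⊤ (r b) trivial ≫ r.stalkMap b).hom a) ≠ 0) :
    ((Ideal.Quotient.mk p).comp ((Scheme.ΓSpecIso (.of O)).inv ≫
      (Spec (.of O)).presheaf.germ ⊤ (r b) trivial ≫ r.stalkMap b).hom).IsIntegral := by
  set φ := ((Scheme.ΓSpecIso (.of O)).inv ≫ (Spec (.of O)).presheaf.germ ⊤ (r b) trivial ≫ r.stalkMap b).hom with hφ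
  set ψ := (Ideal.Quotient.mk p).comp φ with hψ
  letI : Algebra O (P.presheaf.stalk b ⧸ p) := ψ.toAlgebra
  have halg : algebraMap O (P.presheaf.stalk b ⧸ p) = ψ := rfl
  haveI : IsLocalHom (Ideal.Quotient.mk p) := IsLocalHom.of_surjective _ Ideal.Quotient.mk_surjective
  -- `ψ` is local: `𝔪_O ↦ 𝔪_A`
  have hloc : (maximalIdeal O).map (algebraMap O (P.presheaf.stalk b ⧸ p)) ≤ maximalIdeal _ := by
    rw [halg, Ideal.map_le_iff_le_comap]
    intro a ha
    rw [Ideal.mem_comap]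
    by_contra hu
    have hu' : IsUnit (ψ a) := not_not.mp (fun h => hu ((IsLocalRing.mem_maximalIdeal _).mpr h))
    -- a unit of `𝒪_{P,b}/𝔭` lifts to a unit of the local ring `𝒪_{P,b}`
    have hunit : IsUnit (φ a) := isUnit_of_map_unit (Ideal.Quotient.mk p) _ hu'
    exact ((IsLocalRing.mem_maximalIdeal a).mp ha) (isUnit_of_isUnit_stalkMap_germ r hb hunit)
  -- `𝔪_O A` is `𝔪_A`-primary: it is a non-zero ideal of the DVR `A`
  have hprim : ∃ N, maximalIdeal (P.presheaf.stalk b ⧸ p) ^ N ≤ (maximalIdeal O).map (algebraMap O _) := by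
    obtain ⟨a, haO, ha0⟩ := hne
    have hne' : (maximalIdeal O).map (algebraMap O (P.presheaf.stalk b ⧸ p)) ≠ ⊥ := by
      intro h0
      have : ψ a ∈ (maximalIdeal O).map (algebraMap O (P.presheaf.stalk b ⧸ p)) := Ideal.mem_map_of_mem _ haO
      rw [h0, Ideal.mem_bot] at this
      exact ha0 this
    obtain ⟨ϖ, hϖ⟩ := IsDiscreteValuationRing.exists_irreducible (P.presheaf.stalk b ⧸ p)
    obtain ⟨n, hn⟩ := IsDiscreteValuationRing.ideal_eq_span_pow_irreducible hne' hϖ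
    refine ⟨n, ?_⟩
    rw [hn, hϖ.maximalIdeal_eq, Ideal.span_singleton_pow]
  have hres' : Function.Surjective ((residue (P.presheaf.stalk b ⧸ p)).comp (algebraMap O _)) := by
    intro x
    obtain ⟨y, rfl⟩ := Ideal.Quotient.mk_surjective x
    obtain ⟨z, rfl⟩ := Ideal.Quotient.mk_surjective y
    obtain ⟨a, ha⟩ := hres (residue _ z)
    refine ⟨a, ?_⟩
    rw [halg, RingHom.comp_apply, hψ, RingHom.comp_apply]
    -- `residue_A (mk z) = residue_A (mk (φ a))` since `z - φ a ∈ 𝔪`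
    have hza : z - φ a ∈ maximalIdeal (P.presheaf.stalk b) := by
      rw [← Ideal.Quotient.eq]; exact ha.symm
    have : Ideal.Quotient.mk p z - Ideal.Quotient.mk p (φ a) ∈ maximalIdeal (P.presheaf.stalk b ⧸ p) := by
      rw [← map_sub]
      by_contra hu
      have hu' : IsUnit (Ideal.Quotient.mk p (z - φ a)) :=
        not_not.mp fun h => hu ((IsLocalRing.mem_maximalIdeal _).mpr h)
      -- a unit downstairs lifts to a unit of the local ring upstairs
      exact ((IsLocalRing.mem_maximalIdeal _).mp hza) (isUnit_of_map_unit (Ideal.Quotient.mk p) _ hu')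
    exact ((Ideal.Quotient.eq).mpr this).symm
  haveI : Module.Finite O (P.presheaf.stalk b ⧸ p) :=
    module_finite_of_isAdicComplete_of_residue_surjective hloc hres' hprim
  intro x
  exact Algebra.IsIntegral.isIntegral x

/-! ## The structure map through `Spec 𝒪_{P,b}` -/

/-- `Spec 𝒪_{P,b} → P → Spec O` is `Spec` of the structure map `O → 𝒪_{P,b}`. [folklore] -/
theorem fromSpecStalk_comp_eq {O : Type} [CommRing O] {P : Scheme.{0}} (r : P ⟶ Spec (.of O)) (b : P) :
    P.fromSpecStalk b ≫ r =
      Spec.map ((Scheme.ΓSpecIso (.of O)).inv ≫ (Spec (.of O)).presheaf.germ ⊤ (r b) trivial ≫ r.stalkMap b) := by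
  rw [← Scheme.SpecMap_stalkMap_fromSpecStalk, Spec.fromSpecStalk_eq, ← Spec.map_comp]
  rfl

/-- The image in `Spec O` of the generisation `c` of `b` defined by the prime `𝔭 ⊂ 𝒪_{P,b}` is the prime `𝔭 ∩ O`.
[folklore] -/
theorem apply_fromSpecStalk_eq {O : Type} [CommRing O] {P : Scheme.{0}} (r : P ⟶ Spec (.of O)) (b : P)
    (p : Ideal (P.presheaf.stalk b)) [hp : p.IsPrime] :
    r (P.fromSpecStalk b ⟨p, hp⟩) = ⟨p.comap ((Scheme.ΓSpecIso (.of O)).inv ≫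
      (Spec (.of O)).presheaf.germ ⊤ (r b) trivial ≫ r.stalkMap b).hom, inferInstance⟩ := by
  rw [← Scheme.Hom.comp_apply, fromSpecStalk_comp_eq]
  rfl

/-! ## T-MULTISEC: the multisection through `b` defined by a DVR quotient of `𝒪_{P,b}` -/

/-- **[OURS · L1 W4.5(b)] T-MULTISEC, scheme level (given the ring brick).** Let `O` be a COMPLETE discrete valuation ring,
`r : P → Spec O` PROPER, `b` a point of the special fibre (`r b = s₀`) which is `k`-RATIONAL (`O → κ(b)` onto), and let
`𝔭 ⊂ 𝒪_{P,b}` be a prime ideal with `𝒪_{P,b}/𝔭` a discrete valuation ring in which some element of `𝔪_O` is non-zero (the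
output of the ring brick «regular local ring ⇒ DVR quotient avoiding `ϖ`», `Literature.RingTheory.RegularLocalRing`). Let
`c` be the generisation of `b` defined by `𝔭` and `C := 𝓘_{closure {c}}` (`primeDivisorIdeal c`). Then: `supp C = {c, b}`
with `r c ≠ s₀` (so `supp C ∩ r⁻¹{s₀} = {b}` and `C` is finite/quasi-finite over `O`), `V(C)` is INTEGRAL and REGULAR,
`V(C) ↪ P → Spec O` is FLAT, and `C_b = 𝔭` (trace bookkeeping: `𝔭 + (u) = 𝔪_b` ⇒ `I_C·𝒪_{S,b} = 𝔪_{S,b}`). This is the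
RAMIFIED MULTISECTION through `b` of res-L1-w45b-lead-2's MEMO-2 §7 («surface point blow-ups are admissible everywhere»).
NOT a statement of the manuscript. [cite: Matsumura1987, Thm. 8.4; StacksProject, Tag 01W6; Hartshorne1977, III Prop. 9.7] -/
theorem multisection_of_prime {O : Type} [CommRing O] [IsDomain O] [IsDiscreteValuationRing O]
    [IsAdicComplete (maximalIdeal O) O] {P : Scheme.{0}} (r : P ⟶ Spec (.of O)) [IsProper r] {b : P}
    (hb : r b = closedPoint O)
    (hres : Function.Surjective ((residue (P.presheaf.stalk b)).comp ((Scheme.ΓSpecIso (.of O)).inv ≫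
      (Spec (.of O)).presheaf.germ ⊤ (r b) trivial ≫ r.stalkMap b).hom))
    (p : Ideal (P.presheaf.stalk b)) [hp : p.IsPrime] [IsDiscreteValuationRing (P.presheaf.stalk b ⧸ p)]
    (hne : ∃ a ∈ maximalIdeal O, Ideal.Quotient.mk p (((Scheme.ΓSpecIso (.of O)).inv ≫
      (Spec (.of O)).presheaf.germ ⊤ (r b) trivial ≫ r.stalkMap b).hom a) ≠ 0) :
    ((primeDivisorIdeal (P.fromSpecStalk b ⟨p, hp⟩)).support : Set P) = {P.fromSpecStalk b ⟨p, hp⟩, b} ∧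
      r (P.fromSpecStalk b ⟨p, hp⟩) ≠ closedPoint O ∧
      ((primeDivisorIdeal (P.fromSpecStalk b ⟨p, hp⟩)).support : Set P) ∩ r ⁻¹' {closedPoint O} = {b} ∧
      AlgebraicGeometry.IsIntegral (primeDivisorIdeal (P.fromSpecStalk b ⟨p, hp⟩)).subscheme ∧
      Scheme.IsRegular (primeDivisorIdeal (P.fromSpecStalk b ⟨p, hp⟩)).subscheme ∧
      Flat (CategoryStruct.comp (primeDivisorIdeal (P.fromSpecStalk b ⟨p, hp⟩)).subschemeι r) ∧
      stalkIdeal (primeDivisorIdeal (P.fromSpecStalk b ⟨p, hp⟩)) b = p := by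
  set φ := ((Scheme.ΓSpecIso (.of O)).inv ≫ (Spec (.of O)).presheaf.germ ⊤ (r b) trivial ≫ r.stalkMap b).hom with hφ
  set c := P.fromSpecStalk b ⟨p, hp⟩ with hc
  have hcb : c ⤳ b := fromSpecStalk_specializes _
  -- finiteness over the complete base ⇒ `closure {c} = {c, b}`
  have hint := isIntegral_quotient_stalk_of_isAdicComplete r hb p hres hne
  have hcl : closure ({c} : Set P) = {c, b} := closure_fromSpecStalk_eq_pair r b p hint
  have hsupp : ((primeDivisorIdeal c).support : Set P) = {c, b} := by
    rw [coe_support_primeDivisorIdeal, hcl]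
  -- `r c` is the generic point of `Spec O`
  have hrc : r c = ⟨⊥, Ideal.isPrime_bot⟩ := by
    rw [hc, apply_fromSpecStalk_eq]
    apply PrimeSpectrum.ext
    change p.comap φ = ⊥
    -- `𝔭 ∩ O` is a prime of the DVR `O` missing an element of `𝔪_O`, hence `⊥`
    obtain ⟨a, ha, ha0⟩ := hne
    by_contra hne0
    have hmax : (p.comap φ).IsMaximal := (Ideal.comap_isPrime φ p).isMaximal hne0
    have heq : p.comap φ = maximalIdeal O := IsLocalRing.eq_maximalIdeal hmax
    have : a ∈ p.comap φ := heq ▸ ha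
    exact ha0 ((Ideal.Quotient.eq_zero_iff_mem).mpr (Ideal.mem_comap.mp this))
  have hcs : r c ≠ closedPoint O := by
    rw [hrc]
    intro h
    exact IsDiscreteValuationRing.not_a_field O (congrArg PrimeSpectrum.asIdeal h).symm
  refine ⟨hsupp, hcs, ?_, ?_, ?_, ?_, ?_⟩
  · -- special fibre `= {b}`
    rw [hsupp]
    ext y
    constructor
    · rintro ⟨hy | hy, hyF⟩
      · exact absurd (by rw [hy] at hyF; exact hyF) hcs
      · exact hy
    · intro hy
      rw [Set.mem_singleton_iff] at hy
      subst hy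
      exact ⟨Or.inr rfl, hb⟩
  · -- integral: the reduced structure on the irreducible closed set `closure {c}`
    exact ComponentGluing.isIntegral_subscheme_vanishingIdeal _ isIrreducible_singleton.closure
  · -- regular: the two local rings are `𝒪_{P,b}/𝔭` (a DVR) and `κ(c)` (a field)
    have hpb : stalkIdeal (primeDivisorIdeal c) b = p :=
      (stalkIdeal_primeDivisorIdeal hcb).trans (primeOfSpecializes_fromSpecStalk ⟨p, hp⟩)
    have hregb : IsRegularLocalRing (P.presheaf.stalk b ⧸ stalkIdeal (primeDivisorIdeal c) b) :=
      IsRegularLocalRing.of_ringEquiv (R := P.presheaf.stalk b ⧸ p) (Ideal.quotEquivOfEq hpb.symm)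
    have hregc : IsRegularLocalRing (P.presheaf.stalk c ⧸ stalkIdeal (primeDivisorIdeal c) c) :=
      IsRegularLocalRing.of_ringEquiv (R := ResidueField (P.presheaf.stalk c))
        (Ideal.quotEquivOfEq (stalkIdeal_primeDivisorIdeal_self c).symm)
    have key : ∀ y : P, y ∈ ({c, b} : Set P) →
        IsRegularLocalRing (P.presheaf.stalk y ⧸ stalkIdeal (primeDivisorIdeal c) y) := by
      intro y hy
      rcases hy with hy | hy
      · subst hy; exact hregc
      · rw [Set.mem_singleton_iff] at hy
        subst hy; exact hregb
    intro z
    rw [isRegularLocalRing_stalk_subscheme_iff]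
    have hz : (primeDivisorIdeal c).subschemeι z ∈ ((primeDivisorIdeal c).support : Set P) := by
      rw [← Scheme.IdealSheafData.range_subschemeι]; exact ⟨z, rfl⟩
    rw [hsupp] at hz
    exact key _ hz
  · -- flat: an integral scheme dominating `Spec` of a Dedekind domain
    haveI : AlgebraicGeometry.IsIntegral (primeDivisorIdeal c).subscheme :=
      ComponentGluing.isIntegral_subscheme_vanishingIdeal _ isIrreducible_singleton.closure
    haveI : IsDominant (CategoryStruct.comp (primeDivisorIdeal c).subschemeι r) := by
      refine ⟨?_⟩
      obtain ⟨zc, hzc⟩ : c ∈ Set.range (primeDivisorIdeal c).subschemeι := by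
        rw [Scheme.IdealSheafData.range_subschemeι, hsupp]; exact Or.inl rfl
      have hbot : (r c).asIdeal = ⊥ := congrArg PrimeSpectrum.asIdeal hrc
      have hgen : Dense ({r c} : Set (Spec (.of O))) := by
        rw [dense_iff_closure_eq, Set.eq_univ_iff_forall]
        intro x
        have h1 : r c ⤳ x := (PrimeSpectrum.le_iff_specializes (r c) x).mp (by
          show (r c).asIdeal ≤ x.asIdeal
          rw [hbot]; exact bot_le)
        exact specializes_iff_mem_closure.mp h1
      refine hgen.mono ?_
      rintro _ rfl
      exact ⟨zc, by rw [Scheme.Hom.comp_apply, hzc]⟩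
    exact Literature.AlgebraicGeometry.CossartPiltant200819.CP2019.flat_of_isIntegral_of_isDominant _
  · exact (stalkIdeal_primeDivisorIdeal hcb).trans (primeOfSpecializes_fromSpecStalk ⟨p, hp⟩)

end Summit.ResolutionOfSingularities.ResolutionOfSingularities.Cruxes.EquisingularLiftNat.Sections
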